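import Summits.Ventures.PercRepro.S2RankThreeCount

/-!
# PercRepro — S2: THE RANK-`r` SUBSETS OF A SET, COUNTED THROUGH THEIR BASES — THE `N₄` REFINEMENT (p1, gen 31; feeder for sub-claim S2,
owner p7; the twin of p7's S2RankThreeCount, stated for every rank)

On a loopless matroid whose rank-`≤ r` sets have `≤ f` points, the rank-`r` subsets of a set `W` with `j ≥ r + 1` points number at most
`C(|W|, r) · C(f − r, j − r) / (j − r + 1)`: such a set `X` lies in the flat `cl(X)` (`≤ f` points), every rank-`r` `r`-subset `T ⊆ X` spans
that flat, so `X ∖ T` is a `(j − r)`-subset of `cl(T) ∖ T` (`≤ f − r` points) — the pairs `(T, X)` number `≤ C(|W|, r)·C(f − r, j − r)` —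
and every `X` contains `≥ j − r + 1` rank-`r` `r`-subsets (the bases of the loopless rank-`r` restriction `M ↾ X`, S2BasesLower):
**`ncard_rank_subsets_mul_le`** (multiplied out, `N_r(j)·(j + 1 − r) ≤ C(|W|, r)·C(f − r, j − r)`). The instance `r = 4`, `f = 10`
(`ncard_le_ten_of_eRk_le_four_of_free` on the core) is **`ncard_rank_four_subsets_mul_le`**: `N₄(j)·(j − 3) ≤ C(|W|, 4)·C(6, j − 4)`,
the refinement p7's 08:07Z line names for the cases `ν = d − 2` of `(14, 10)` and `(14, 8)`; `r = 3`, `f = 6` recovers p7's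
`ncard_rank_three_subsets_mul_le`. Axioms: standard.
-/

open scoped Matroid

namespace PercRepro

namespace S2

variable {α : Type}

/-- **A rank-`r` set contains `≥ |X| − r + 1` rank-`r` `r`-subsets** (the bases of the loopless restriction `M ↾ X`; S2BasesLower). -/
theorem ncard_rank_bases_ge (M : Matroid α) [M.Finite] (hL : ∀ e ∈ M.E, ¬ M.IsLoop e)
    {X : Set α} (hX : X ⊆ M.E) {r : ℕ} (hXr : M.eRk X = r) :
    X.ncard + 1 ≤ {T : Set α | T ⊆ X ∧ T.ncard = r ∧ M.eRk T = r}.ncard + r := by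
  classical
  have hXfin : X.Finite := M.ground_finite.subset hX
  haveI : (M ↾ X).Finite := M.restrict_finite hXfin
  obtain ⟨B₀, hB₀⟩ := (M ↾ X).exists_isBase
  have hB₀' : M.IsBasis B₀ X := (Matroid.isBase_restrict_iff hX).1 hB₀
  have hB₀fin : B₀.Finite := hXfin.subset hB₀'.subset
  have hB₀card : B₀.ncard = r := by
    have h := hB₀'.encard_eq_eRk
    rw [hXr, ← hB₀fin.cast_ncard_eq] at h
    exact_mod_cast h
  have hL' : ∀ e ∈ (M ↾ X).E, ¬ (M ↾ X).IsLoop e := by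
    intro e _ hl
    rw [Matroid.restrict_isLoop_iff] at hl
    rcases hl.2 with h | h
    · exact hL e (hX hl.1) h
    · exact h (hX hl.1)
  have key := ncard_add_one_le_ncard_isBase_add (M ↾ X) hL' hB₀
  rw [Matroid.restrict_ground_eq, hB₀card] at key
  have hsub : {B : Set α | (M ↾ X).IsBase B} ⊆ {T : Set α | T ⊆ X ∧ T.ncard = r ∧ M.eRk T = r} := by
    intro B hB
    have hB' : M.IsBasis B X := (Matroid.isBase_restrict_iff hX).1 hB
    have hBfin : B.Finite := hXfin.subset hB'.subset
    have hr : B.encard = r := by rw [hB'.encard_eq_eRk, hXr]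
    refine ⟨hB'.subset, ?_, ?_⟩
    · rw [← hBfin.cast_ncard_eq] at hr
      exact_mod_cast hr
    · rw [hB'.indep.eRk_eq_encard, hr]
  have hfinT : {T : Set α | T ⊆ X ∧ T.ncard = r ∧ M.eRk T = r}.Finite :=
    hXfin.finite_subsets.subset (fun T hT => hT.1)
  have := Set.ncard_le_ncard hsub hfinT
  omega

/-- **`N_r(j)`**: on a loopless matroid whose rank-`≤ r` sets have `≤ f` points, the rank-`r` `j`-subsets of `W ⊆ E` (`j ≥ r + 1`) satisfy
`N_r(j) · (j + 1 − r) ≤ C(|W|, r) · C(f − r, j − r)`. -/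
theorem ncard_rank_subsets_mul_le (M : Matroid α) [M.Finite] (hL : ∀ e ∈ M.E, ¬ M.IsLoop e)
    {r f : ℕ} (hflat : ∀ P ⊆ M.E, M.eRk P ≤ r → P.ncard ≤ f) {W : Set α} (hW : W ⊆ M.E) (j : ℕ) (hj : r + 1 ≤ j) :
    {X : Set α | X ⊆ W ∧ X.ncard = j ∧ M.eRk X = r}.ncard * (j + 1 - r) ≤ W.ncard.choose r * Nat.choose (f - r) (j - r) := by
  classical
  have hWfin : W.Finite := M.ground_finite.subset hW
  have h𝒳fin : {X : Set α | X ⊆ W ∧ X.ncard = j ∧ M.eRk X = r}.Finite :=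
    hWfin.finite_subsets.subset (fun X hX => hX.1)
  have h𝒯fin : {T : Set α | T ⊆ W ∧ T.ncard = r}.Finite :=
    hWfin.finite_subsets.subset (fun T hT => hT.1)
  have h𝒯card : {T : Set α | T ⊆ W ∧ T.ncard = r}.ncard = W.ncard.choose r := ncard_subsets_ncard_eq W hWfin r
  -- the double count on the finsets
  set s : Finset (Set α) := h𝒳fin.toFinset with hs
  set t : Finset (Set α) := h𝒯fin.toFinset with ht
  let rel : Set α → Set α → Prop := fun X T => T ⊆ X ∧ M.eRk T = r
  have hm : ∀ X ∈ s, j + 1 - r ≤ (t.bipartiteAbove rel X).card := by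
    intro X hXs
    rw [hs, Set.Finite.mem_toFinset] at hXs
    obtain ⟨hXW, hXj, hXr⟩ := hXs
    have h1 := ncard_rank_bases_ge M hL (hXW.trans hW) hXr
    rw [hXj] at h1
    have hsub : {T : Set α | T ⊆ X ∧ T.ncard = r ∧ M.eRk T = r} ⊆ (t.bipartiteAbove rel X : Set (Set α)) := by
      intro T hT
      rw [Finset.coe_bipartiteAbove]
      refine ⟨?_, hT.1, hT.2.2⟩
      rw [ht, Set.Finite.mem_toFinset]
      exact ⟨hT.1.trans hXW, hT.2.1⟩
    have h2 := Set.ncard_le_ncard hsub (Finset.finite_toSet _)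
    rw [Set.ncard_coe_finset] at h2
    omega
  have hn : ∀ T ∈ t, (s.bipartiteBelow rel T).card ≤ Nat.choose (f - r) (j - r) := by
    intro T hTt
    rw [ht, Set.Finite.mem_toFinset] at hTt
    obtain ⟨hTW, hTr⟩ := hTt
    have hTE : T ⊆ M.E := hTW.trans hW
    have hTfin : T.Finite := hWfin.subset hTW
    -- the sets X of the fibre lie in the flat `cl(T)` when `ρ(T) = r`; map `X ↦ X ∖ T`
    by_cases hTrk : M.eRk T = r
    · have hclE : M.closure T ⊆ M.E := M.closure_subset_ground T
      have hclr : M.eRk (M.closure T) ≤ r := by rw [M.eRk_closure_eq, hTrk]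
      have hclcard : (M.closure T).ncard ≤ f := hflat _ hclE hclr
      have hclfin : (M.closure T).Finite := M.ground_finite.subset hclE
      have hTcl : T ⊆ M.closure T := M.subset_closure T hTE
      have hZcard : (M.closure T \ T).ncard ≤ f - r := by
        rw [Set.ncard_sdiff hTcl hTfin, hTr]
        omega
      have hfib : ((s.bipartiteBelow rel T : Finset (Set α)) : Set (Set α)).ncard ≤
          {Y : Set α | Y ⊆ M.closure T \ T ∧ Y.ncard = j - r}.ncard := by
        refine Set.ncard_le_ncard_of_injOn (fun X => X \ T) ?_ ?_
          (hclfin.finite_subsets.subset (fun Y hY => hY.1.trans Set.sdiff_subset))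
        · intro X hX
          rw [Finset.mem_coe, Finset.mem_bipartiteBelow] at hX
          obtain ⟨hXs, hTX, -⟩ := hX
          rw [hs, Set.Finite.mem_toFinset] at hXs
          obtain ⟨hXW, hXj, hXr⟩ := hXs
          -- X ⊆ cl(T): cl(T) = cl(X) since T ⊆ X and ρ(X) ≤ ρ(T)
          have hrk : M.IsRkFinite T := M.isRkFinite_of_finite hTfin
          have hcl : M.closure T = M.closure X :=
            hrk.closure_eq_closure_of_subset_of_eRk_ge_eRk hTX (by rw [hXr, hTrk])
          have hXcl : X ⊆ M.closure T := by
            rw [hcl]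
            exact M.subset_closure X (hXW.trans hW)
          refine ⟨Set.sdiff_subset_sdiff_left hXcl, ?_⟩
          rw [Set.ncard_sdiff hTX hTfin, hXj, hTr]
        · intro X hX Y hY hXY
          rw [Finset.mem_coe, Finset.mem_bipartiteBelow] at hX hY
          have hTX : T ⊆ X := hX.2.1
          have hTY : T ⊆ Y := hY.2.1
          simp only at hXY
          rw [← Set.sdiff_union_of_subset hTX, ← Set.sdiff_union_of_subset hTY, hXY]
      rw [Set.ncard_coe_finset, ncard_subsets_ncard_eq _ (hclfin.subset Set.sdiff_subset)] at hfib
      exact hfib.trans (Nat.choose_le_choose _ hZcard)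
    · -- no X of the fibre: the relation needs `ρ(T) = r`
      have hempty : s.bipartiteBelow rel T = ∅ := by
        rw [Finset.eq_empty_iff_forall_notMem]
        intro X hX
        rw [Finset.mem_bipartiteBelow] at hX
        exact hTrk hX.2.2
      rw [hempty, Finset.card_empty]
      exact Nat.zero_le _
  have hdc := Finset.card_mul_le_card_mul rel hm hn
  have hs_card : s.card = {X : Set α | X ⊆ W ∧ X.ncard = j ∧ M.eRk X = r}.ncard := by
    rw [hs, Set.ncard_eq_toFinset_card _ h𝒳fin]
  have ht_card : t.card = {T : Set α | T ⊆ W ∧ T.ncard = r}.ncard := by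
    rw [ht, Set.ncard_eq_toFinset_card _ h𝒯fin]
  rw [hs_card, ht_card, h𝒯card] at hdc
  exact hdc

/-- **`N₄(j)`** (the instance `r = 4`, `f = 10`): on a loopless matroid whose rank-`≤ 4` sets have `≤ 10` points, the rank-`4` `j`-subsets of
`W ⊆ E` (`j ≥ 5`) satisfy `N₄(j) · (j − 3) ≤ C(|W|, 4) · C(6, j − 4)`. -/
theorem ncard_rank_four_subsets_mul_le (M : Matroid α) [M.Finite] (hL : ∀ e ∈ M.E, ¬ M.IsLoop e)
    (hflat : ∀ P ⊆ M.E, M.eRk P ≤ 4 → P.ncard ≤ 10) {W : Set α} (hW : W ⊆ M.E) (j : ℕ) (hj : 5 ≤ j) :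
    {X : Set α | X ⊆ W ∧ X.ncard = j ∧ M.eRk X = 4}.ncard * (j - 3) ≤ W.ncard.choose 4 * Nat.choose 6 (j - 4) := by
  have h := ncard_rank_subsets_mul_le M hL (r := 4) (f := 10) hflat hW j (by omega)
  have hj3 : j + 1 - 4 = j - 3 := by omega
  rw [hj3] at h
  exact h

/-- **`N₃(j)` again** (the instance `r = 3`, `f = 6`): p7's `ncard_rank_three_subsets_mul_le` as the same statement. -/
theorem ncard_rank_three_subsets_mul_le' (M : Matroid α) [M.Finite] (hL : ∀ e ∈ M.E, ¬ M.IsLoop e)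
    (hplane : ∀ P ⊆ M.E, M.eRk P ≤ 3 → P.ncard ≤ 6) {W : Set α} (hW : W ⊆ M.E) (j : ℕ) (hj : 4 ≤ j) :
    {X : Set α | X ⊆ W ∧ X.ncard = j ∧ M.eRk X = 3}.ncard * (j - 2) ≤ W.ncard.choose 3 * Nat.choose 3 (j - 3) := by
  have h := ncard_rank_subsets_mul_le M hL (r := 3) (f := 6) hplane hW j (by omega)
  have hj2 : j + 1 - 3 = j - 2 := by omega
  rw [hj2] at h
  exact h

end S2

end PercRepro
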